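import Summits.HodgeConjecture.HodgeConjecture.Theorems.EightfoldBlochSeedsBlochSeedsGenericRegularImmersionOfRegularSubscheme
import Literature.AlgebraicGeometry.Resolution.AlterationsSectionDivisor
import Literature.AlgebraicGeometry.Motives.CyclesDimensionProofs
import Literature.AlgebraicGeometry.Motives.BettiCycleClassProofs
import Mathlib.AlgebraicGeometry.Properties
import HarnessLib

/-!
# Route `EightfoldBlochSeeds`, cruxes `BlochSeedsGeneric` / `BlochSeedDiscThree` (items stmt-HodgeConjecture-18880 / 18882),
# stub `stub_pad4_carrier`: SMOOTH ⊂ SMOOTH ⟹ REGULAR IMMERSION OF THE EXPECTED CODIMENSION, with NO dimension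
# hypothesis at the stalks (EGA IV 17.12.1) — the `IsRegularImmersionOfCodim _ 4` clause of the named fact (K)
# `kleiman1969_smoothingCycles_eightfold_codimFour` for Kleiman's smooth connected degeneracy fourfold

HONEST FRAMING. `--supports` helper; nothing here proves the stub, (K), the crux, H2, HC_AV or HC. No definition, no named
fact (D-0026).

WHAT. `isRegularImmersionOfCodim_of_smoothOfRelativeDimension` — for a field `k`, `X` irreducible and smooth of relative
dimension `n` over `k`, and a closed immersion `i : Z ⟶ X` with `Z` irreducible and smooth of relative dimension `m` over `k`,
`m + p = n`: `IsRegularImmersionOfCodim i p`. The stalk dimension formula `dim (𝒪_{X,iz} ⧸ 𝓘_{iz}) + p = dim 𝒪_{X,iz}`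
required by `isRegularImmersionOfCodim_of_smooth_of_ringKrullDim` (previous file) is COMPUTED: `𝒪_{X,iz} ⧸ 𝓘_{iz} ≅ 𝒪_{Z,z}`
(`Resolution.stalkIdeal_ker_eq_ker_stalkMap`, surjectivity of `i` on stalks), `dim 𝒪 = coheight` (Mathlib
`ringKrullDim_stalk_eq_coheight`), `height + coheight = n` resp. `m` on irreducible smooth schemes
(`Motives.height_add_coheight_eq_of_smoothOfRelativeDimension`) and `height (i z) = height z`
(`Motives.Scheme.height_base_eq_of_isClosedImmersion`). So on the (K) road the local-complete-intersection clause for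
Kleiman's locus `D ⊂ X` (smooth, connected — hence irreducible — of dimension `4` in the smooth projective irreducible
eightfold `X`) is now a THEOREM given `D` smooth of relative dimension `4`; what remains of (K) is Chern classes /
Thom–Porteous / Kleiman–Bertini / Fulton–Lazarsfeld (K1–K4).

[cite: EGAIV4, Prop. 17.12.1] [cite: Hartshorne1977, II Ex. 3.20 (d)] [cite: GortzWedhorn2023, Def. 19.19]
-/

noncomputable section

-- single-problem summit (Problem = Summit): the mandated namespace repeats `HodgeConjecture`.
set_option linter.dupNamespace false

open CategoryTheory AlgebraicGeometry TopologicalSpace IsLocalRing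
open Literature.AlgebraicGeometry.HodgeTheory Literature.AlgebraicGeometry.Resolution Literature.AlgebraicGeometry.Motives

namespace Summit.HodgeConjecture.HodgeConjecture.Theorems

universe u

/-- **The stalk dimension formula for a closed immersion of irreducible smooth schemes over a field**: if `X` is
irreducible, smooth of relative dimension `n`, `Z` irreducible, smooth of relative dimension `m`, `i : Z ⟶ X` a closed
immersion and `m + p = n`, then `dim (𝒪_{X,iz} ⧸ 𝓘_{iz}) + p = dim 𝒪_{X,iz}` at every `z`
(`𝒪_{X,iz} ⧸ 𝓘_{iz} ≅ 𝒪_{Z,z}`, `dim 𝒪 = coheight`, `height + coheight = n` / `m`, `height (i z) = height z`).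
[cite: Hartshorne1977, II Ex. 3.20 (d)] [cite: EGAIV4, Prop. 17.12.1] -/
theorem ringKrullDim_stalk_quotient_add_eq_of_smoothOfRelativeDimension {k : Type u} [Field k] {X Z : Scheme.{u}}
    (f : X ⟶ Spec (CommRingCat.of k)) {n m p : ℕ} [SmoothOfRelativeDimension n f] [IrreducibleSpace X]
    (i : Z ⟶ X) [IsClosedImmersion i] [SmoothOfRelativeDimension m (i ≫ f)] [IrreducibleSpace Z]
    (hmn : m + p = n) (z : Z) :
    ringKrullDim (X.presheaf.stalk (i.base z) ⧸ stalkIdeal i.ker (i.base z)) + p =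
      ringKrullDim (X.presheaf.stalk (i.base z)) := by
  have hq : ringKrullDim (X.presheaf.stalk (i.base z) ⧸ stalkIdeal i.ker (i.base z)) =
      ringKrullDim (Z.presheaf.stalk z) := by
    rw [stalkIdeal_ker_eq_ker_stalkMap i z,
      ringKrullDim_eq_of_ringEquiv (RingHom.quotientKerEquivOfSurjective (i.stalkMap_surjective z))]
  rw [hq, ringKrullDim_stalk_eq_coheight, ringKrullDim_stalk_eq_coheight]
  have hX := height_add_coheight_eq_of_smoothOfRelativeDimension f n (i.base z)
  have hZ := height_add_coheight_eq_of_smoothOfRelativeDimension (i ≫ f) m z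
  have hh : Order.height (i.base z) = Order.height z := Scheme.height_base_eq_of_isClosedImmersion i z
  -- arithmetic in `ℕ∞`: all quantities are finite
  have hfin : Order.height z ≠ ⊤ := by
    intro htop
    rw [htop, top_add] at hZ
    exact (ENat.coe_ne_top m) hZ.symm
  obtain ⟨a, ha⟩ := ENat.ne_top_iff_exists.mp hfin
  have hcZ : Order.coheight z ≠ ⊤ := by
    intro htop
    rw [htop, add_top] at hZ
    exact (ENat.coe_ne_top m) hZ.symm
  have hcX : Order.coheight (i.base z) ≠ ⊤ := by
    intro htop
    rw [htop, add_top] at hX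
    exact (ENat.coe_ne_top n) hX.symm
  obtain ⟨b, hb⟩ := ENat.ne_top_iff_exists.mp hcZ
  obtain ⟨c, hc⟩ := ENat.ne_top_iff_exists.mp hcX
  rw [← ha, ← hb] at hZ
  rw [hh, ← ha, ← hc] at hX
  have hZ' : a + b = m := by exact_mod_cast hZ
  have hX' : a + c = n := by exact_mod_cast hX
  have hbc : b + p = c := by omega
  rw [← hb, ← hc, ← hbc]
  rfl

/-- **Smooth ⊂ smooth ⟹ regular immersion of the expected codimension** (EGA IV 17.12.1, in the tree's currency
`IsRegularImmersionOfCodim`, no stalk hypothesis left): `X` irreducible and smooth of relative dimension `n` over a field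
`k`, `i : Z ⟶ X` a closed immersion with `Z` irreducible and smooth of relative dimension `m` over `k`, `m + p = n` ⟹
`IsRegularImmersionOfCodim i p`. For (K): `X` a smooth projective (geometrically irreducible) eightfold, `D` Kleiman's
smooth connected — hence irreducible — degeneracy fourfold, `p = 4`.
[cite: EGAIV4, Prop. 17.12.1] [cite: GortzWedhorn2023, Def. 19.19] [cite: Matsumura1987, Thm. 14.2] -/
theorem isRegularImmersionOfCodim_of_smoothOfRelativeDimension {k : Type u} [Field k] {X Z : Scheme.{u}}
    (f : X ⟶ Spec (CommRingCat.of k)) {n m p : ℕ} [SmoothOfRelativeDimension n f] [IrreducibleSpace X]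
    (i : Z ⟶ X) [IsClosedImmersion i] [SmoothOfRelativeDimension m (i ≫ f)] [IrreducibleSpace Z]
    (hmn : m + p = n) : IsRegularImmersionOfCodim i p := by
  haveI : Smooth f := SmoothOfRelativeDimension.smooth n f
  haveI : Smooth (i ≫ f) := SmoothOfRelativeDimension.smooth m (i ≫ f)
  exact isRegularImmersionOfCodim_of_smooth_of_ringKrullDim f i
    (ringKrullDim_stalk_quotient_add_eq_of_smoothOfRelativeDimension f i hmn)

end Summit.HodgeConjecture.HodgeConjecture.Theorems

end
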